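import Summits.HodgeConjecture.CorCM.PairwiseCMFamiliesHodge
import Literature.NumberTheory.ComplexMultiplication.PartialConjugationOfOneConjugate
import HarnessLib

/-!
# A Galois closure meeting ONE CONJUGATE of the partner field in a totally real field: rank additivity, the Hodge
# conjecture on every `∏_i A_i^{k_i}`, and the cyclic-quartic slot

COR-CM (cell `pub-hodgecm2`, binder seat `b16` gen 40, count-neutral claim SxF-ONECONJ (F2)); NEW as stated, hence under
`Summits/`.  Theorems only; no definition, no named fact, no `sorry`.

The tree decides the stable nondegeneracy of a product `∏_i A_i` of CM abelian varieties (realisations of CM types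
`(K_i; Φ_i)`) through the pairwise "no common constituent" criterion (`PairwiseCMFamiliesHodge`:
`isNondegenerateFamily_iff_forall_of_pairwise`).  Its Galois-theoretic menu for a pair of slots `(a, b)` asks that complex
conjugation fix `L_a ∩ L_b` pointwise, `L_a`, `L_b` the GALOIS CLOSURES in `ℂ` (`forall_exists_partialConj_pair`,
`SimpleCMSurfaceTimesCMHodge`, …).  The literature file `NumberTheory/ComplexMultiplication/PartialConjugationOfOneConjugate`
(this seat) lowers the price to ONE CONJUGATE: it suffices that conjugation fix `L_a ∩ y₀(K_b)` pointwise for a single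
embedding `y₀ : K_b → ℂ` (then some `σ ∈ Aut(ℂ)` is conjugation on `Hom(K_a, ℂ)` and fixes the point `y₀` of the
transitive `Aut(ℂ)`-set `Hom(K_b, ℂ)`, which already excludes common constituents).  For a non-Galois partner `K_b` this
is strictly weaker — `K_a ⊆ L_b` is allowed as long as `K_a` meets the conjugate `y₀(K_b)` in a real field — and it is
the uniform mechanism behind Moonen–Zarhin's dichotomy "`k ↪ End⁰(X₂)` or not" [MoonenZarhin1999LowDim, Thm. (0.2)] and its
higher analogues (this seat's `CyclicCMSurfaceTimesCMHodge`: a cyclic quartic CM field `K_S ↪ K_A` or not).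

* §0 **`pairwise_of_oneConjugate`** — conj fixes `L_a ∩ y₀(K_b)` ⟹ no common constituent for `(a, b)` and `(b, a)`;
  **`pairwise_of_cyclic_quartic_of_isEmpty`** — the same for `K_a` cyclic quartic CM with `IsEmpty (K_a →+* K_b)`.
* §1 two slots: **`isNondegenerateFamily_iff_pair_of_oneConjugate`** (`(Φ_{i₀}, Φ_{i₁})` is nondegenerate iff both
  members are), `cmFamilyRank_add_two_eq_of_oneConjugate` (`rank Hg(A₀ × A₁) = rank Hg(A₀) + rank Hg(A₁)`); any number of
  slots: **`isNondegenerateFamily_iff_of_forall_oneConjugate`** under the hypothesis for every unordered pair (in one of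
  the two orders).
* §2 geometry: **`hodgeConjectureFor_prod_pair_of_oneConjugate`** — for realisations `A₀`, `A₁` of nondegenerate types
  whose fields satisfy the one-conjugate condition, the Hodge conjecture and `B• = D•` on EVERY `A₀^a × A₁^b`
  (every `⨁_{j<N} A_{π j}`), UNCONDITIONALLY; `hodgeConjectureFor_prod_of_forall_oneConjugate` (families).

## References

* [MoonenZarhin1999LowDim] B. Moonen, Yu. Zarhin, *Hodge classes on abelian varieties of low dimension*, Math. Ann.
  315 (1999) 711–733, Thm. (0.2) (a)/(4), Cor. (3.9).
* [Gordon1999HodgeAVSurvey] B. B. Gordon, *A survey of the Hodge conjecture for abelian varieties*, §3 Theorem (Imai,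
  Murty) with proof; 7.5–7.7; 10.10.
* [Lang2002] S. Lang, *Algebra*, GTM 211, VI §1 Thm. 1.12.
* [Shimura1998] G. Shimura, *Abelian Varieties with Complex Multiplication and Modular Functions*, §8.4 Example (2)(B).
-/

noncomputable section

open CategoryTheory CategoryTheory.Limits NumberField NumberField.ComplexEmbedding IntermediateField
open scoped BigOperators

namespace Summit.HodgeConjecture.CorCM

open Literature.NumberTheory.ComplexMultiplication
open Literature.AlgebraicGeometry.Motives (AbelianVariety CMType)
open Literature.AlgebraicGeometry.HodgeTheory
open Literature.AlgebraicGeometry.ComplexMultiplication (IsCMTypeRealisation)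
open Literature.AlgebraicGeometry.VanGeemen1994 (hodgeClassSpan)
open Literature.AlgebraicGeometry.Pohlmann1968
open Literature.Barriers.HodgeConjecture (divisorClassesSpan)

/-! ## §0 One conjugate suffices -/

section Fields

variable {I : Type} {K : I → Type} [∀ i, Field (K i)] [∀ i, NumberField (K i)] [∀ i, IsCMField (K i)]

/-- **Conjugation fixing `L_a ∩ y₀(K_b)` excludes common constituents, in both orders.**  If for ONE embedding
`y₀ : K_b → ℂ` complex conjugation fixes `L_a ∩ y₀(K_b)` pointwise (`L_a` the Galois closure of `K_a` in `ℂ`), then no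
non-zero `Aut(ℂ)`-stable `P ≤ U(Φ_a)` maps equivariantly and injectively into `U(Φ_b)`, nor vice versa: some
`σ ∈ Aut(ℂ)` is conjugation on `Hom(K_a, ℂ)` and fixes the point `y₀` of the transitive `Aut(ℂ)`-set `Hom(K_b, ℂ)`.
[cite: MoonenZarhin1999LowDim, Thm. (0.2) (4) and Cor. (3.9)] [cite: Gordon1999HodgeAVSurvey, §3 Theorem (proof)] -/
theorem pairwise_of_oneConjugate (Φ : ∀ i, CMType (K i)) {a b : I} (y₀ : K b →+* ℂ)
    (hreal : ∀ x : ℂ, x ∈ normalClosure ℚ (K a) ℂ → x ∈ y₀.toRatAlgHom.fieldRange → starRingEnd ℂ x = x) :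
    (∀ P : Submodule ℚ ((K a →+* ℂ) → ℚ), P ≤ antiSpan (ℂ ≃+* ℂ) (Φ a).1 →
      (∀ g : ℂ ≃+* ℂ, ∀ f ∈ P, (fun x => f (g • x)) ∈ P) →
      ∀ T : ((K a →+* ℂ) → ℚ) →ₗ[ℚ] ((K b →+* ℂ) → ℚ),
        (∀ g : ℂ ≃+* ℂ, ∀ f ∈ P, T (fun x => f (g • x)) = fun y => T f (g • y)) →
        (∀ f ∈ P, T f ∈ antiSpan (ℂ ≃+* ℂ) (Φ b).1) → (∀ f ∈ P, T f = 0 → f = 0) → P = ⊥) ∧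
    (∀ P : Submodule ℚ ((K b →+* ℂ) → ℚ), P ≤ antiSpan (ℂ ≃+* ℂ) (Φ b).1 →
      (∀ g : ℂ ≃+* ℂ, ∀ f ∈ P, (fun x => f (g • x)) ∈ P) →
      ∀ T : ((K b →+* ℂ) → ℚ) →ₗ[ℚ] ((K a →+* ℂ) → ℚ),
        (∀ g : ℂ ≃+* ℂ, ∀ f ∈ P, T (fun x => f (g • x)) = fun y => T f (g • y)) →
        (∀ f ∈ P, T f ∈ antiSpan (ℂ ≃+* ℂ) (Φ a).1) → (∀ f ∈ P, T f = 0 → f = 0) → P = ⊥) := by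
  obtain ⟨σ, hσa, hσb⟩ := exists_ringEquiv_conj_smul_and_smul_eq (k := K a) (K := K b) y₀ hreal
  haveI := isPretransitive_ringEquiv_complex (K := K b)
  exact pairwise_of_rho_on_slot_of_smul_eq (G := ℂ ≃+* ℂ) (Φ := fun i => (Φ i).1)
    (fun i => isCMTypeWith_conj (Φ i)) (i := a) (j := b) hσa hσb fun y => MulAction.exists_smul_eq (ℂ ≃+* ℂ) y₀ y

/-- **A cyclic quartic CM slot foreign to `K_b` has no common constituent with the slot `b`** (both orders): for `K_a`
cyclic quartic CM and `IsEmpty (K_a →+* K_b)`, conjugation fixes `L_a ∩ y₀(K_b)` for every `y₀` (degree `≤ 2` inside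
`L_a`).  No condition on the Galois closure `L_b` (`K_a ⊆ L_b` allowed). [cite: Shimura1998, §8.4 Example (2)(B)]
[cite: Gordon1999HodgeAVSurvey, §3 Theorem (proof)] -/
theorem pairwise_of_cyclic_quartic_of_isEmpty (Φ : ∀ i, CMType (K i)) {a b : I} [IsGalois ℚ (K a)]
    [IsCyclic (K a ≃ₐ[ℚ] K a)] (h4 : Module.finrank ℚ (K a) = 4) (he : IsEmpty (K a →+* K b)) :
    (∀ P : Submodule ℚ ((K a →+* ℂ) → ℚ), P ≤ antiSpan (ℂ ≃+* ℂ) (Φ a).1 →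
      (∀ g : ℂ ≃+* ℂ, ∀ f ∈ P, (fun x => f (g • x)) ∈ P) →
      ∀ T : ((K a →+* ℂ) → ℚ) →ₗ[ℚ] ((K b →+* ℂ) → ℚ),
        (∀ g : ℂ ≃+* ℂ, ∀ f ∈ P, T (fun x => f (g • x)) = fun y => T f (g • y)) →
        (∀ f ∈ P, T f ∈ antiSpan (ℂ ≃+* ℂ) (Φ b).1) → (∀ f ∈ P, T f = 0 → f = 0) → P = ⊥) ∧
    (∀ P : Submodule ℚ ((K b →+* ℂ) → ℚ), P ≤ antiSpan (ℂ ≃+* ℂ) (Φ b).1 →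
      (∀ g : ℂ ≃+* ℂ, ∀ f ∈ P, (fun x => f (g • x)) ∈ P) →
      ∀ T : ((K b →+* ℂ) → ℚ) →ₗ[ℚ] ((K a →+* ℂ) → ℚ),
        (∀ g : ℂ ≃+* ℂ, ∀ f ∈ P, T (fun x => f (g • x)) = fun y => T f (g • y)) →
        (∀ f ∈ P, T f ∈ antiSpan (ℂ ≃+* ℂ) (Φ a).1) → (∀ f ∈ P, T f = 0 → f = 0) → P = ⊥) :=
  let y₀ : K b →+* ℂ := Classical.choice inferInstance
  pairwise_of_oneConjugate Φ y₀ fun _ h₁ h₂ => conj_apply_eq_of_cyclic_quartic_of_isEmpty h4 he y₀ h₁ h₂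

end Fields

/-! ## §1 Rank additivity and the nondegeneracy criterion -/

section Rank

variable {I : Type} {K : I → Type} [∀ i, Field (K i)] [∀ i, NumberField (K i)] [∀ i, IsCMField (K i)] [Fintype I]
  [DecidableEq I]

omit [Fintype I] [DecidableEq I] in
/-- **The pairwise criterion from one-conjugate conditions on every pair** (for each unordered pair `{i, j}`, in one
of the two orders, conjugation fixes `L_i ∩ y₀(K_j)` for some `y₀`). [cite: Gordon1999HodgeAVSurvey, §3 Theorem (proof)] -/
theorem pairwise_of_forall_oneConjugate (Φ : ∀ i, CMType (K i))
    (h : ∀ i j, i ≠ j →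
      (∃ y₀ : K j →+* ℂ, ∀ x : ℂ, x ∈ normalClosure ℚ (K i) ℂ → x ∈ y₀.toRatAlgHom.fieldRange →
        starRingEnd ℂ x = x) ∨
      (∃ y₀ : K i →+* ℂ, ∀ x : ℂ, x ∈ normalClosure ℚ (K j) ℂ → x ∈ y₀.toRatAlgHom.fieldRange →
        starRingEnd ℂ x = x)) :
    ∀ i j, i ≠ j → ∀ P : Submodule ℚ ((K i →+* ℂ) → ℚ), P ≤ antiSpan (ℂ ≃+* ℂ) (Φ i).1 →
      (∀ g : ℂ ≃+* ℂ, ∀ f ∈ P, (fun x => f (g • x)) ∈ P) →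
      ∀ T : ((K i →+* ℂ) → ℚ) →ₗ[ℚ] ((K j →+* ℂ) → ℚ),
        (∀ g : ℂ ≃+* ℂ, ∀ f ∈ P, T (fun x => f (g • x)) = fun y => T f (g • y)) →
        (∀ f ∈ P, T f ∈ antiSpan (ℂ ≃+* ℂ) (Φ j).1) → (∀ f ∈ P, T f = 0 → f = 0) → P = ⊥ := by
  intro i j hij
  rcases h i j hij with ⟨y₀, hy₀⟩ | ⟨y₀, hy₀⟩
  · exact (pairwise_of_oneConjugate Φ y₀ hy₀).1
  · exact (pairwise_of_oneConjugate Φ (a := j) (b := i) y₀ hy₀).2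

/-- **Nondegeneracy criterion under one-conjugate conditions on every pair**: `(Φ_i)_i` is nondegenerate iff every
`Φ_i` is (`∏_i A_i` stably nondegenerate iff every factor is). [cite: Gordon1999HodgeAVSurvey, §3 Theorem and 7.5] -/
theorem isNondegenerateFamily_iff_of_forall_oneConjugate [Nonempty I] (Φ : ∀ i, CMType (K i))
    (h : ∀ i j, i ≠ j →
      (∃ y₀ : K j →+* ℂ, ∀ x : ℂ, x ∈ normalClosure ℚ (K i) ℂ → x ∈ y₀.toRatAlgHom.fieldRange →
        starRingEnd ℂ x = x) ∨
      (∃ y₀ : K i →+* ℂ, ∀ x : ℂ, x ∈ normalClosure ℚ (K j) ℂ → x ∈ y₀.toRatAlgHom.fieldRange →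
        starRingEnd ℂ x = x)) :
    CMAlgebra.IsNondegenerateFamily Φ ↔ ∀ i, IsNondegenerate (Φ i) :=
  isNondegenerateFamily_iff_forall_of_pairwise Φ (pairwise_of_forall_oneConjugate Φ h)

/-- **Rank additivity under one-conjugate conditions on every pair**: `rank((Φ_i)_i) + |I| = Σ_i rank(Φ_i) + 1`
(`Hg(∏_i A_i) = ∏_i Hg(A_i)`). [cite: Gordon1999HodgeAVSurvey, §3 Theorem (1)] -/
theorem cmFamilyRank_add_card_eq_of_forall_oneConjugate [Nonempty I] (Φ : ∀ i, CMType (K i))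
    (h : ∀ i j, i ≠ j →
      (∃ y₀ : K j →+* ℂ, ∀ x : ℂ, x ∈ normalClosure ℚ (K i) ℂ → x ∈ y₀.toRatAlgHom.fieldRange →
        starRingEnd ℂ x = x) ∨
      (∃ y₀ : K i →+* ℂ, ∀ x : ℂ, x ∈ normalClosure ℚ (K j) ℂ → x ∈ y₀.toRatAlgHom.fieldRange →
        starRingEnd ℂ x = x)) :
    CMAlgebra.cmFamilyRank Φ + Fintype.card I = (∑ i, cmTypeRank (Φ i)) + 1 :=
  cmFamilyRank_add_card_eq_of_pairwise Φ (pairwise_of_forall_oneConjugate Φ h)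

/-- **Two slots, one conjugate**: if conjugation fixes `L_{i₀} ∩ y₀(K_{i₁})` pointwise for one `y₀ : K_{i₁} → ℂ`, the
pair `(Φ_{i₀}, Φ_{i₁})` is nondegenerate iff both members are. [cite: Gordon1999HodgeAVSurvey, §3 Theorem and 7.5]
[cite: MoonenZarhin1999LowDim, Thm. (0.2) (4)] -/
theorem isNondegenerateFamily_iff_pair_of_oneConjugate {i₀ i₁ : I} (h01 : i₀ ≠ i₁) (hI : ∀ j, j = i₀ ∨ j = i₁)
    (Φ : ∀ i, CMType (K i)) (y₀ : K i₁ →+* ℂ)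
    (hreal : ∀ x : ℂ, x ∈ normalClosure ℚ (K i₀) ℂ → x ∈ y₀.toRatAlgHom.fieldRange → starRingEnd ℂ x = x) :
    CMAlgebra.IsNondegenerateFamily Φ ↔ ∀ i, IsNondegenerate (Φ i) := by
  haveI : Nonempty I := ⟨i₀⟩
  refine isNondegenerateFamily_iff_of_forall_oneConjugate Φ fun i j hij => ?_
  rcases hI i with rfl | rfl
  · rcases hI j with rfl | rfl
    · exact absurd rfl hij
    · exact Or.inl ⟨y₀, hreal⟩
  · rcases hI j with rfl | rfl
    · exact Or.inr ⟨y₀, hreal⟩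
    · exact absurd rfl hij

/-- **Two slots, one conjugate: `rank(Φ_{i₀}, Φ_{i₁}) + 2 = rank(Φ_{i₀}) + rank(Φ_{i₁}) + 1`**
(`Hg(A₀ × A₁) = Hg(A₀) × Hg(A₁)`). [cite: Gordon1999HodgeAVSurvey, §3 Theorem (1)] -/
theorem cmFamilyRank_add_card_eq_pair_of_oneConjugate {i₀ i₁ : I} (h01 : i₀ ≠ i₁) (hI : ∀ j, j = i₀ ∨ j = i₁)
    (Φ : ∀ i, CMType (K i)) (y₀ : K i₁ →+* ℂ)
    (hreal : ∀ x : ℂ, x ∈ normalClosure ℚ (K i₀) ℂ → x ∈ y₀.toRatAlgHom.fieldRange → starRingEnd ℂ x = x) :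
    CMAlgebra.cmFamilyRank Φ + Fintype.card I = (∑ i, cmTypeRank (Φ i)) + 1 := by
  haveI : Nonempty I := ⟨i₀⟩
  refine cmFamilyRank_add_card_eq_of_forall_oneConjugate Φ fun i j hij => ?_
  rcases hI i with rfl | rfl
  · rcases hI j with rfl | rfl
    · exact absurd rfl hij
    · exact Or.inl ⟨y₀, hreal⟩
  · rcases hI j with rfl | rfl
    · exact Or.inr ⟨y₀, hreal⟩
    · exact absurd rfl hij

/-- **Two slots, a cyclic quartic CM field foreign to the partner**: for `K_{i₀}` cyclic quartic CM with
`IsEmpty (K_{i₀} →+* K_{i₁})` the pair is nondegenerate iff `Φ_{i₁}` is (every type of a cyclic quartic CM field is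
nondegenerate). [cite: Shimura1998, §8.4 Example (2)(B)] [cite: Gordon1999HodgeAVSurvey, §3 Theorem and 7.5] -/
theorem isNondegenerateFamily_iff_pair_of_cyclic_quartic_of_isEmpty {i₀ i₁ : I} (h01 : i₀ ≠ i₁)
    (hI : ∀ j, j = i₀ ∨ j = i₁) (Φ : ∀ i, CMType (K i)) [IsGalois ℚ (K i₀)] [IsCyclic (K i₀ ≃ₐ[ℚ] K i₀)]
    (h4 : Module.finrank ℚ (K i₀) = 4) (he : IsEmpty (K i₀ →+* K i₁)) :
    CMAlgebra.IsNondegenerateFamily Φ ↔ IsNondegenerate (Φ i₁) := by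
  obtain ⟨y₀⟩ : Nonempty (K i₁ →+* ℂ) := inferInstance
  rw [isNondegenerateFamily_iff_pair_of_oneConjugate h01 hI Φ y₀
    fun _ h₁ h₂ => conj_apply_eq_of_cyclic_quartic_of_isEmpty h4 he y₀ h₁ h₂]
  refine ⟨fun h => h i₁, fun h i => ?_⟩
  rcases hI i with rfl | rfl
  · exact isNondegenerate_of_isCyclic_of_finrank_eq_four h4 (Φ _)
  · exact h

end Rank

/-! ## §2 Geometry: the Hodge conjecture on every `∏_i A_i^{k_i}` -/

section Geometry

variable {I : Type} {K : I → Type} [∀ i, Field (K i)] [∀ i, NumberField (K i)] [∀ i, IsCMField (K i)] [Fintype I]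
  [DecidableEq I] {Φ : ∀ i, CMType (K i)}
variable {A : I → AbelianVariety ℂ} {ι : ∀ i, 𝓞 (K i) →+* End (A i)}
  {θ : ∀ i, K i →+* Module.End ℂ (complexBetti (A i).X 1)}

/-- **One-conjugate conditions on every pair and nondegenerate members: the Hodge conjecture and `B• = D•` on EVERY
`⨁_{j<N} A_{π j}`** (every `∏_i A_i^{k_i}`), UNCONDITIONALLY, for realisations `(A_i, ι_i, θ_i)` of the `(K_i; Φ_i)`.
[cite: Gordon1999HodgeAVSurvey, §3 Theorem, 7.5 and 10.10] -/
theorem hodgeConjectureFor_prod_of_forall_oneConjugate [Nonempty I]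
    (h : ∀ i j, i ≠ j →
      (∃ y₀ : K j →+* ℂ, ∀ x : ℂ, x ∈ normalClosure ℚ (K i) ℂ → x ∈ y₀.toRatAlgHom.fieldRange →
        starRingEnd ℂ x = x) ∨
      (∃ y₀ : K i →+* ℂ, ∀ x : ℂ, x ∈ normalClosure ℚ (K j) ℂ → x ∈ y₀.toRatAlgHom.fieldRange →
        starRingEnd ℂ x = x))
    (hΦ : ∀ i, IsNondegenerate (Φ i)) (hA : ∀ i, IsCMTypeRealisation (Φ i) (A i) (ι i) (θ i)) {N : ℕ}
    (π : Fin N → I) :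
    HodgeConjectureFor (⨁ fun j : Fin N => A (π j)).dim (⨁ fun j : Fin N => A (π j)).X ∧
      ∀ m : ℕ, hodgeClassSpan (⨁ fun j : Fin N => A (π j)).dim (⨁ fun j : Fin N => A (π j)).X m =
        divisorClassesSpan (⨁ fun j : Fin N => A (π j)).X (⨁ fun j : Fin N => A (π j)).dim m :=
  have hnd := (isNondegenerateFamily_iff_of_forall_oneConjugate Φ h).2 hΦ
  ⟨hnd.hodgeConjectureFor_prod hA π, fun m => hnd.hodgeClassSpan_prod_eq_divisorClassesSpan hA π m⟩

/-- **Two CM abelian varieties `A₀`, `A₁` of nondegenerate types whose fields meet the one-conjugate condition**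
(conjugation fixes `L_{i₀} ∩ y₀(K_{i₁})` for one `y₀`): the Hodge conjecture and `B• = D•` on EVERY `A₀^a × A₁^b`,
UNCONDITIONALLY — Moonen–Zarhin's (0.2) (4) "`B•(Xⁿ) = D•(Xⁿ)` for all `n`" in the CM case, for arbitrary dimensions.
[cite: MoonenZarhin1999LowDim, Thm. (0.2) (4)] [cite: Gordon1999HodgeAVSurvey, §3 Theorem, 7.5 and 10.10] -/
theorem hodgeConjectureFor_prod_pair_of_oneConjugate {i₀ i₁ : I} (h01 : i₀ ≠ i₁) (hI : ∀ j, j = i₀ ∨ j = i₁)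
    (y₀ : K i₁ →+* ℂ)
    (hreal : ∀ x : ℂ, x ∈ normalClosure ℚ (K i₀) ℂ → x ∈ y₀.toRatAlgHom.fieldRange → starRingEnd ℂ x = x)
    (hΦ : ∀ i, IsNondegenerate (Φ i)) (hA : ∀ i, IsCMTypeRealisation (Φ i) (A i) (ι i) (θ i)) {N : ℕ}
    (π : Fin N → I) :
    HodgeConjectureFor (⨁ fun j : Fin N => A (π j)).dim (⨁ fun j : Fin N => A (π j)).X ∧
      ∀ m : ℕ, hodgeClassSpan (⨁ fun j : Fin N => A (π j)).dim (⨁ fun j : Fin N => A (π j)).X m =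
        divisorClassesSpan (⨁ fun j : Fin N => A (π j)).X (⨁ fun j : Fin N => A (π j)).dim m :=
  haveI : Nonempty I := ⟨i₀⟩
  have hnd := (isNondegenerateFamily_iff_pair_of_oneConjugate h01 hI Φ y₀ hreal).2 hΦ
  ⟨hnd.hodgeConjectureFor_prod hA π, fun m => hnd.hodgeClassSpan_prod_eq_divisorClassesSpan hA π m⟩

end Geometry

end Summit.HodgeConjecture.CorCM

end
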